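import Summits.CriticalPhenomena.PercolationContinuityZ3.Theorems.Transplant.SkelFrmFrom1ReachRowsQUV
import Summits.CriticalPhenomena.PercolationContinuityZ3.Theorems.Transplant.SkelFrmFromBChoiceDefsVPx
import Summits.CriticalPhenomena.PercolationContinuityZ3.Theorems.Transplant.SkelFrmFromBChoiceAtQVPx
import Summits.CriticalPhenomena.PercolationContinuityZ3.Theorems.Transplant.SkelFrmFromBChoiceZonePx
import Summits.CriticalPhenomena.PercolationContinuityZ3.Theorems.Transplant.SkelFrmFromBChoiceZoneKPx
import HarnessLib

/-!
# GEN ROW (RULING D-Us, lead g21 V147b / Us-R1–R4 lead g22; WAVE-Us-MANIFEST v1.0 §3/§9, (C) REACH column) «SkelFrmFrom1ReachRowsQUVPxK» — the GENERALISED twin of «SkelFrmFrom1ReachRowsQUV»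
# (U idx 106) IN THE K-2 SHAPE THE (C) TOPS READ: **the (C) residue at one probe, second axis `u`-form, under proxies** (`reachOblAtHNF_frmQ3VD_sndUPxK`)

builds on p205010 (kernel theorem, internal audit signed; external expert review pending) — nothing in this file uses p205010; NOTHING about the OPEN node U_s
(`SamePDropOfSkeletonFrmScaled₁`) is claimed; no statement, no `@[conjecture]`, def-free.  Lane `prim-bschramm`, seat `prim-bschramm-gen-1` g0 (GEN pen, (C) column per
RULING Us-R3); helper file (`--supports stmt-CriticalPhenomena-4575 --as helper`).  THE K-2 SHAPE (why a second form): the (C) TOPS go through hp-8's row bundles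
`HX_QV`/`HY_QV`, whose corridor record radius `R′ = KS0.R'0 κ Φ t p D mk`, creep and reading rows are computed from ONE record at ONE index — so at the tops the kit
must sit at the SAME record `O.merged` at the RAISED INDEX `mkP := KS.RK t O.merged mk + D` (KitBump §4 K-2, `RK_add_le_RK_raise_of_atQ`), not at the bumped record;
this file is the row in that shape: kit at a free `(Dk, mkP)` for every `KS./KS0.` apron head (+ the apron `Mu Dk`), tied to the served region by
`hRK : KS.RK t O.merged mk + D ≤ KS.RK t Dk mkP`; the junction region handed to the φ-level callee is the EXPLICIT radius-`(RK mk + D)` kit parallelogram at `(O, mk)`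
(«SkelFrmFromBChoiceZoneKPx» prism form) with `hRg ⊆ B(c, Rs t Dk mkP)` / `hRgcard ≤ cUA Φ t Dk mkP` proved inline from `hRK` and `hΛRgK` from `hΛRg_of_atQPx` — the
(R) column's shape («SkelFrmFrom1RootHoldsQCKVPx» :146–:163, p3 g27) token for token; no junction hypothesis is left.  The K-1 module «SkelFrmFrom1ReachRowsQUVPx» (kit at `(Dk, mk)`, region
`KS.RgK G t Dk mk`, hypothesis `hΛRgK` dischargeable at `Dk := O.merged.bumpR D`) stays in the tree, audited, TRUE — it is simply not the form the top reads.  Other GEN hunks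
as there (tool `bin/port_c_pxk.py`): (i) `h1 ↦ hP`, `hAt` of the Px choice data; served inputs `hlong/hlongY_of_atQ3VPx` (prism radius `RL + D` ⇒ `r = Rl := RL + D`),
zones `Λ ∘ prox` at `M_u` via «…ZonePx»; (iii) width floors from `AtQNQ` of the Px data (C-4); (iv) the kit block / counts / levels / corridor record `R′` at `(Dk, mkP)`
(identities valid for every `DataNS` and index — no fact about `O` consumed there: C-1).  L-side byte-identical to the U twin.
[cite: KozmaNitzan2024, §4 Lemma 12 (pp. 23–25), p. 30 (Step IV); pp. 19–21 ((21)–(25))] [cite: BenjaminiSchramm1996, Conj. 4] [this work]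
-/

noncomputable section

open MeasureTheory ProbabilityTheory
open scoped ENNReal Classical

namespace Summit.CriticalPhenomena.PercolationContinuityZ3.Theorems.Transplant

namespace PlanarSkeletonFrmFrom

open Literature.Probability.Percolation Literature.Probability.LatticeModels SimpleGraph GadgetSystem ProbeHistory HSiteScheme Contour KNCells
open Literature.Probability.Percolation.KozmaNitzan.Cells (oth sgOf)
open KNCells.KSchA KNLevels ChainPlanar ChainPara
open Literature.Barriers.CriticalPhenomena (HasExponentialGrowth graphBall graphBall_mono mem_graphBall_self)
open Skel (ReachOblAtHNF excess)
open SkelI (tanOff)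
open SkelConc (Consts)
open BoxProdZ2 (ConcRadiiG)
open TwoAxis.Para (modulus)
open Skelφ (oriφ trφ)
open Skelφ.StepI (DataN DataNS OutNS)

namespace NegB

open Neg

section Fst

variable {κ : Consts} {V : Type} [DecidableEq V] [Countable V] {G : SimpleGraph V} [G.LocallyFinite] {Φ : PlanarSkeletonFrmFrom G} {t : V} {p : unitInterval}
  {hC : Φ.CylSubcritical p} {gv fv : Neg.FSlot} {Pv : PSlot} {Sv : SSlot} {cv hv : CSlot} {bv : BSlot} {O : OutNS V} {q : unitInterval}

/-- [UNDER PROXIES, K-2 SHAPE: kit at `(Dk, mkP)` with `hRK`; junction = the explicit radius-`(RK mk + D)` prism at `(O, mk)`; long radius `RL + D`; `hAt` of the Px data]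
**THE (C) RESIDUE OF THE CHOICE FUNCTION OF RECORD AT ONE PROBE, SECOND AXIS** (over `reachOblAtHNF_of_kgCorrYV`; the schedule's frame rows are the
`KGYRows` fields `hn/hv/hlay`). [cite: KozmaNitzan2024, §4 Lemma 12 (pp. 23–25), p. 30 (Step IV)] -/
theorem reachOblAtHNF_frmQ3VD_sndUPxK {κ : Consts} {V : Type} [DecidableEq V] [Countable V] {G : SimpleGraph V} [G.LocallyFinite] {Φ : PlanarSkeletonFrmFrom G} {t : V} {p : unitInterval} {hC : Φ.CylSubcritical p} {gv : Neg.FSlot} {fv : Neg.FSlot} {Pv : PSlot} {Sv : SSlot} {cv : CSlot} {hv : CSlot} {bv : BSlot} {O : OutNS V} {q : unitInterval} {D : ℕ} (hAt : (choiceAtQ3VPx κ Φ t p D Pv gv fv Sv cv hv bv hC).AtQNQ O q) (hP : Φ.HasProxies t D)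
    (hp0 : 0 < (p : ℝ)) (hp1 : (p : ℝ) < 1) (mk : ℕ)
    -- UNDER PROXIES (K-2 shape): the KIT RECORD / INDEX `(Dk, mkP)` for every `KS./KS0.` apron head, tied to the served region at `(O, mk)` by `hRK`
    (Dk : DataNS V) (mkP : ℕ) (hRK : KS.RK t O.merged mk + D ≤ KS.RK t Dk mkP)
    -- the probe
    {h : ProbeHistory V} {e : Site 2 × MDir} (hV : (((KSchA.mk (ΓQV κ Φ t p O gv fv Sv cv hv bv q) q κ.δ : KSchA V ℕ))).Valid₂O G h e) (hdu : ((((1 : Fin 2), true) : MDir)) ∈ (((KSchA.mk (ΓQV κ Φ t p O gv fv Sv cv hv bv q) q κ.δ : KSchA V ℕ))).onwardO G h (tgt e)) (hne : ((((1 : Fin 2), true) : MDir)) ≠ rev e.2)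
    -- the corridor of record, second axis: the K-G row set at `R′ := KS0.R'0` and a run length `N` (stmt-g20: `kgYRows0_of …`, `N := kgNYv0 …`)
    {ρ qq W : ℕ} (HK : Skelφ.KGYRows (nL κ Φ t p O.merged (gOf κ Φ t p O gv) (fOf κ Φ t p O fv)) (ℓL κ Φ t p O.merged (gOf κ Φ t p O gv) (fOf κ Φ t p O fv)) (hL κ Φ t p O.merged (gOf κ Φ t p O gv) (fOf κ Φ t p O fv)) (vL κ Φ t p O.merged (gOf κ Φ t p O gv) (fOf κ Φ t p O fv)) (KS0.R'0 κ Φ t p Dk mkP) ρ qq W) (N : ℕ)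
    -- the window radius
    {R : ℕ} (hr₀R : KS0.r₀0 t Dk mkP (RL κ Φ t p O gv fv + D) ≤ R)
    -- RADIUS ROWS of the schedule of record
    (hDQ : R + 1 ≤ ((schedOfT κ Φ t p O.merged (gOf κ Φ t p O gv) (fOf κ Φ t p O fv) (cOf κ Φ t p O gv fv cv) (Sv κ Φ t p O.merged (gOf κ Φ t p O gv) (fOf κ Φ t p O fv) q))).rQ ((((KSchA.mk (ΓQV κ Φ t p O gv fv Sv cv hv bv q) q κ.δ : KSchA V ℕ))).aOf₁O G h e) (tgt e))
    (hDρ' : ∀ l, R + 1 ≤ ((schedOfT κ Φ t p O.merged (gOf κ Φ t p O gv) (fOf κ Φ t p O fv) (cOf κ Φ t p O gv fv cv) (Sv κ Φ t p O.merged (gOf κ Φ t p O gv) (fOf κ Φ t p O fv) q))).ρ ((((KSchA.mk (ΓQV κ Φ t p O gv fv Sv cv hv bv q) q κ.δ : KSchA V ℕ))).aOf₂O G h e) (tgt e) ((((1 : Fin 2), true) : MDir)) l)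
    (hρM : ∀ l, ((schedOfT κ Φ t p O.merged (gOf κ Φ t p O gv) (fOf κ Φ t p O fv) (cOf κ Φ t p O gv fv cv) (Sv κ Φ t p O.merged (gOf κ Φ t p O gv) (fOf κ Φ t p O fv) q))).ρ ((((KSchA.mk (ΓQV κ Φ t p O gv fv Sv cv hv bv q) q κ.δ : KSchA V ℕ))).aOf₂O G h e) (tgt e) ((((1 : Fin 2), true) : MDir)) l + 1 ≤ ((schedOfT κ Φ t p O.merged (gOf κ Φ t p O gv) (fOf κ Φ t p O fv) (cOf κ Φ t p O gv fv cv) (Sv κ Φ t p O.merged (gOf κ Φ t p O gv) (fOf κ Φ t p O fv) q))).rM ((((KSchA.mk (ΓQV κ Φ t p O gv fv Sv cv hv bv q) q κ.δ : KSchA V ℕ))).aOf₂O G h e) (tgt e + stepVec ((((1 : Fin 2), true) : MDir))))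
    -- THE ENTRANCE DEPTH (J15; the wrapper: `deep_of_run₂bOV`, `R₀ := E(nS α v)`)
    {R₀ : ℕ} (hdeep : ∀ a ∈ (((KSchA.mk (ΓQV κ Φ t p O gv fv Sv cv hv bv q) q κ.δ : KSchA V ℕ))).Vx G h, ∀ b ∈ (((KSchA.mk (ΓQV κ Φ t p O gv fv Sv cv hv bv q) q κ.δ : KSchA V ℕ))).Γ.Ewv ((((KSchA.mk (ΓQV κ Φ t p O gv fv Sv cv hv bv q) q κ.δ : KSchA V ℕ))).aOf₁O G h e) e.1 e.2 ∪ ((FDQV κ Φ t p O gv fv Sv cv hv q)).Hfull ((((KSchA.mk (ΓQV κ Φ t p O gv fv Sv cv hv bv q) q κ.δ : KSchA V ℕ))).aOf₂O G h e) (tgt e) ((((1 : Fin 2), true) : MDir)),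
      b ∉ (((KSchA.mk (ΓQV κ Φ t p O gv fv Sv cv hv bv q) q κ.δ : KSchA V ℕ))).Vx G h → G.Adj a b → a ∈ graphBall G t R₀)
    -- PER-REGION READING ROWS of the second-axis corridor (J17; boxes e.g. `kgCorrSchedY_region_run_box/_park₁_box/_park₂_box`)
    (hPR : ∀ k ≤ (Skelφ.kgCorrSchedY HK.hn HK.hv HK.hlay (HK.kgYVals_ok₁ N) (HK.kgYVals_ok₂ N) (HK.kgYVals_split N)).N, ∃ lo hi : Site 2,
      (Skelφ.kgCorrSchedY HK.hn HK.hv HK.hlay (HK.kgYVals_ok₁ N) (HK.kgYVals_ok₂ N) (HK.kgYVals_split N)).region k ⊆ Finset.Icc lo hi ∧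
      (-(5 * (((fcellsV κ Φ t p O.merged (gOf κ Φ t p O gv) (fOf κ Φ t p O fv) (cOf κ Φ t p O gv fv cv) (hOf κ Φ t p O gv fv hv))).r 1 : ℤ)) + 1 ≤ Skelφ.rdLo ((prFA κ Φ t p O.merged (gOf κ Φ t p O gv) (fOf κ Φ t p O fv))).A (nL κ Φ t p O.merged (gOf κ Φ t p O gv) (fOf κ Φ t p O fv)) (hL κ Φ t p O.merged (gOf κ Φ t p O gv) (fOf κ Φ t p O fv)) (vL κ Φ t p O.merged (gOf κ Φ t p O gv) (fOf κ Φ t p O fv)) (vβL κ Φ t p O.merged (gOf κ Φ t p O gv) (fOf κ Φ t p O fv)) ((prFA κ Φ t p O.merged (gOf κ Φ t p O gv) (fOf κ Φ t p O fv))).c₀ ((prFA κ Φ t p O.merged (gOf κ Φ t p O gv) (fOf κ Φ t p O fv))).c₁ ((prFA κ Φ t p O.merged (gOf κ Φ t p O gv) (fOf κ Φ t p O fv))).D lo hi 1 ∧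
        Skelφ.rdHi ((prFA κ Φ t p O.merged (gOf κ Φ t p O gv) (fOf κ Φ t p O fv))).A (nL κ Φ t p O.merged (gOf κ Φ t p O gv) (fOf κ Φ t p O fv)) (hL κ Φ t p O.merged (gOf κ Φ t p O gv) (fOf κ Φ t p O fv)) (vL κ Φ t p O.merged (gOf κ Φ t p O gv) (fOf κ Φ t p O fv)) (vβL κ Φ t p O.merged (gOf κ Φ t p O gv) (fOf κ Φ t p O fv)) ((prFA κ Φ t p O.merged (gOf κ Φ t p O gv) (fOf κ Φ t p O fv))).c₀ ((prFA κ Φ t p O.merged (gOf κ Φ t p O gv) (fOf κ Φ t p O fv))).c₁ ((prFA κ Φ t p O.merged (gOf κ Φ t p O gv) (fOf κ Φ t p O fv))).D lo hi 1 ≤ 22 * (((fcellsV κ Φ t p O.merged (gOf κ Φ t p O gv) (fOf κ Φ t p O fv) (cOf κ Φ t p O gv fv cv) (hOf κ Φ t p O gv fv hv))).r 1 : ℤ) - 1) ∧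
      (-(((fcellsV κ Φ t p O.merged (gOf κ Φ t p O gv) (fOf κ Φ t p O fv) (cOf κ Φ t p O gv fv cv) (hOf κ Φ t p O gv fv hv))).hB 1 : ℤ) + 1 ≤ Skelφ.rdLo ((prFA κ Φ t p O.merged (gOf κ Φ t p O gv) (fOf κ Φ t p O fv))).A (nL κ Φ t p O.merged (gOf κ Φ t p O gv) (fOf κ Φ t p O fv)) (hL κ Φ t p O.merged (gOf κ Φ t p O gv) (fOf κ Φ t p O fv)) (vL κ Φ t p O.merged (gOf κ Φ t p O gv) (fOf κ Φ t p O fv)) (vβL κ Φ t p O.merged (gOf κ Φ t p O gv) (fOf κ Φ t p O fv)) ((prFA κ Φ t p O.merged (gOf κ Φ t p O gv) (fOf κ Φ t p O fv))).c₀ ((prFA κ Φ t p O.merged (gOf κ Φ t p O gv) (fOf κ Φ t p O fv))).c₁ ((prFA κ Φ t p O.merged (gOf κ Φ t p O gv) (fOf κ Φ t p O fv))).D lo hi 0 ∧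
        Skelφ.rdHi ((prFA κ Φ t p O.merged (gOf κ Φ t p O gv) (fOf κ Φ t p O fv))).A (nL κ Φ t p O.merged (gOf κ Φ t p O gv) (fOf κ Φ t p O fv)) (hL κ Φ t p O.merged (gOf κ Φ t p O gv) (fOf κ Φ t p O fv)) (vL κ Φ t p O.merged (gOf κ Φ t p O gv) (fOf κ Φ t p O fv)) (vβL κ Φ t p O.merged (gOf κ Φ t p O gv) (fOf κ Φ t p O fv)) ((prFA κ Φ t p O.merged (gOf κ Φ t p O gv) (fOf κ Φ t p O fv))).c₀ ((prFA κ Φ t p O.merged (gOf κ Φ t p O gv) (fOf κ Φ t p O fv))).c₁ ((prFA κ Φ t p O.merged (gOf κ Φ t p O gv) (fOf κ Φ t p O fv))).D lo hi 0 ≤ (((fcellsV κ Φ t p O.merged (gOf κ Φ t p O gv) (fOf κ Φ t p O fv) (cOf κ Φ t p O gv fv cv) (hOf κ Φ t p O gv fv hv))).hF 1 : ℤ) - 1))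
    -- READING ROWS of the arrival box `[kgLastLoY, kgLastHiY]` (SkelPhiCorridorKGBoxes)
    (hLl : 20 * (((fcellsV κ Φ t p O.merged (gOf κ Φ t p O gv) (fOf κ Φ t p O fv) (cOf κ Φ t p O gv fv cv) (hOf κ Φ t p O gv fv hv))).r 1 : ℤ) - (bOf κ Φ t p O gv fv bv) 1 + 1 ≤ Skelφ.rdLo ((prFA κ Φ t p O.merged (gOf κ Φ t p O gv) (fOf κ Φ t p O fv))).A (nL κ Φ t p O.merged (gOf κ Φ t p O gv) (fOf κ Φ t p O fv)) (hL κ Φ t p O.merged (gOf κ Φ t p O gv) (fOf κ Φ t p O fv)) (vL κ Φ t p O.merged (gOf κ Φ t p O gv) (fOf κ Φ t p O fv)) (vβL κ Φ t p O.merged (gOf κ Φ t p O gv) (fOf κ Φ t p O fv)) ((prFA κ Φ t p O.merged (gOf κ Φ t p O gv) (fOf κ Φ t p O fv))).c₀ ((prFA κ Φ t p O.merged (gOf κ Φ t p O gv) (fOf κ Φ t p O fv))).c₁ ((prFA κ Φ t p O.merged (gOf κ Φ t p O gv) (fOf κ Φ t p O fv))).D (HK.kgLastLoY N) (HK.kgLastHiY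 N) 1 ∧
      5 * (((fcellsV κ Φ t p O.merged (gOf κ Φ t p O gv) (fOf κ Φ t p O fv) (cOf κ Φ t p O gv fv cv) (hOf κ Φ t p O gv fv hv))).r 1 : ℤ) ≤ Skelφ.rdLo ((prFA κ Φ t p O.merged (gOf κ Φ t p O gv) (fOf κ Φ t p O fv))).A (nL κ Φ t p O.merged (gOf κ Φ t p O gv) (fOf κ Φ t p O fv)) (hL κ Φ t p O.merged (gOf κ Φ t p O gv) (fOf κ Φ t p O fv)) (vL κ Φ t p O.merged (gOf κ Φ t p O gv) (fOf κ Φ t p O fv)) (vβL κ Φ t p O.merged (gOf κ Φ t p O gv) (fOf κ Φ t p O fv)) ((prFA κ Φ t p O.merged (gOf κ Φ t p O gv) (fOf κ Φ t p O fv))).c₀ ((prFA κ Φ t p O.merged (gOf κ Φ t p O gv) (fOf κ Φ t p O fv))).c₁ ((prFA κ Φ t p O.merged (gOf κ Φ t p O gv) (fOf κ Φ t p O fv))).D (HK.kgLastLoY N) (HK.kgLastHiY N) 1 ∧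
      Skelφ.rdHi ((prFA κ Φ t p O.merged (gOf κ Φ t p O gv) (fOf κ Φ t p O fv))).A (nL κ Φ t p O.merged (gOf κ Φ t p O gv) (fOf κ Φ t p O fv)) (hL κ Φ t p O.merged (gOf κ Φ t p O gv) (fOf κ Φ t p O fv)) (vL κ Φ t p O.merged (gOf κ Φ t p O gv) (fOf κ Φ t p O fv)) (vβL κ Φ t p O.merged (gOf κ Φ t p O gv) (fOf κ Φ t p O fv)) ((prFA κ Φ t p O.merged (gOf κ Φ t p O gv) (fOf κ Φ t p O fv))).c₀ ((prFA κ Φ t p O.merged (gOf κ Φ t p O gv) (fOf κ Φ t p O fv))).c₁ ((prFA κ Φ t p O.merged (gOf κ Φ t p O gv) (fOf κ Φ t p O fv))).D (HK.kgLastLoY N) (HK.kgLastHiY N) 1 ≤ 20 * (((fcellsV κ Φ t p O.merged (gOf κ Φ t p O gv) (fOf κ Φ t p O fv) (cOf κ Φ t p O gv fv cv) (hOf κ Φ t p O gv fv hv))).r 1 : ℤ) + (bOf κ Φ t p O gv fv bv) 1 - 1 ∧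
      Skelφ.rdHi ((prFA κ Φ t p O.merged (gOf κ Φ t p O gv) (fOf κ Φ t p O fv))).A (nL κ Φ t p O.merged (gOf κ Φ t p O gv) (fOf κ Φ t p O fv)) (hL κ Φ t p O.merged (gOf κ Φ t p O gv) (fOf κ Φ t p O fv)) (vL κ Φ t p O.merged (gOf κ Φ t p O gv) (fOf κ Φ t p O fv)) (vβL κ Φ t p O.merged (gOf κ Φ t p O gv) (fOf κ Φ t p O fv)) ((prFA κ Φ t p O.merged (gOf κ Φ t p O gv) (fOf κ Φ t p O fv))).c₀ ((prFA κ Φ t p O.merged (gOf κ Φ t p O gv) (fOf κ Φ t p O fv))).c₁ ((prFA κ Φ t p O.merged (gOf κ Φ t p O gv) (fOf κ Φ t p O fv))).D (HK.kgLastLoY N) (HK.kgLastHiY N) 1 ≤ 22 * (((fcellsV κ Φ t p O.merged (gOf κ Φ t p O gv) (fOf κ Φ t p O fv) (cOf κ Φ t p O gv fv cv) (hOf κ Φ t p O gv fv hv))).r 1 : ℤ))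
    (hLt : ((fcellsV κ Φ t p O.merged (gOf κ Φ t p O gv) (fOf κ Φ t p O fv) (cOf κ Φ t p O gv fv cv) (hOf κ Φ t p O gv fv hv))).cenS (tgt e + stepVec ((((1 : Fin 2), true) : MDir))) 0 - ((fcellsV κ Φ t p O.merged (gOf κ Φ t p O gv) (fOf κ Φ t p O fv) (cOf κ Φ t p O gv fv cv) (hOf κ Φ t p O gv fv hv))).cenS (tgt e) 0 - (bOf κ Φ t p O gv fv bv) 0 + 1 ≤ Skelφ.rdLo ((prFA κ Φ t p O.merged (gOf κ Φ t p O gv) (fOf κ Φ t p O fv))).A (nL κ Φ t p O.merged (gOf κ Φ t p O gv) (fOf κ Φ t p O fv)) (hL κ Φ t p O.merged (gOf κ Φ t p O gv) (fOf κ Φ t p O fv)) (vL κ Φ t p O.merged (gOf κ Φ t p O gv) (fOf κ Φ t p O fv)) (vβL κ Φ t p O.merged (gOf κ Φ t p O gv) (fOf κ Φ t p O fv)) ((prFA κ Φ t p O.merged (gOf κ Φ t p O gv) (fOf κ Φ t p O fv))).c₀ ((prFA κ Φ t p O.merged (gOf κ Φ t p O gv) (fOf κ Φ t p O fv))).c₁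 ((prFA κ Φ t p O.merged (gOf κ Φ t p O gv) (fOf κ Φ t p O fv))).D (HK.kgLastLoY N) (HK.kgLastHiY N) 0 ∧
      Skelφ.rdHi ((prFA κ Φ t p O.merged (gOf κ Φ t p O gv) (fOf κ Φ t p O fv))).A (nL κ Φ t p O.merged (gOf κ Φ t p O gv) (fOf κ Φ t p O fv)) (hL κ Φ t p O.merged (gOf κ Φ t p O gv) (fOf κ Φ t p O fv)) (vL κ Φ t p O.merged (gOf κ Φ t p O gv) (fOf κ Φ t p O fv)) (vβL κ Φ t p O.merged (gOf κ Φ t p O gv) (fOf κ Φ t p O fv)) ((prFA κ Φ t p O.merged (gOf κ Φ t p O gv) (fOf κ Φ t p O fv))).c₀ ((prFA κ Φ t p O.merged (gOf κ Φ t p O gv) (fOf κ Φ t p O fv))).c₁ ((prFA κ Φ t p O.merged (gOf κ Φ t p O gv) (fOf κ Φ t p O fv))).D (HK.kgLastLoY N) (HK.kgLastHiY N) 0 ≤ ((fcellsV κ Φ t p O.merged (gOf κ Φ t p O gv) (fOf κ Φ t p O fv) (cOf κ Φ t p O gv fv cv) (hOf κ Φ t p O gv fv hv))).cenS (tgt e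 + stepVec ((((1 : Fin 2), true) : MDir))) 0 - ((fcellsV κ Φ t p O.merged (gOf κ Φ t p O gv) (fOf κ Φ t p O fv) (cOf κ Φ t p O gv fv cv) (hOf κ Φ t p O gv fv hv))).cenS (tgt e) 0 + (bOf κ Φ t p O gv fv bv) 0 - 1 ∧
      -(((fcellsV κ Φ t p O.merged (gOf κ Φ t p O gv) (fOf κ Φ t p O fv) (cOf κ Φ t p O gv fv cv) (hOf κ Φ t p O gv fv hv))).hB 1 : ℤ) ≤ Skelφ.rdLo ((prFA κ Φ t p O.merged (gOf κ Φ t p O gv) (fOf κ Φ t p O fv))).A (nL κ Φ t p O.merged (gOf κ Φ t p O gv) (fOf κ Φ t p O fv)) (hL κ Φ t p O.merged (gOf κ Φ t p O gv) (fOf κ Φ t p O fv)) (vL κ Φ t p O.merged (gOf κ Φ t p O gv) (fOf κ Φ t p O fv)) (vβL κ Φ t p O.merged (gOf κ Φ t p O gv) (fOf κ Φ t p O fv)) ((prFA κ Φ t p O.merged (gOf κ Φ t p O gv) (fOf κ Φ t p O fv))).c₀ ((prFA κ Φ t p O.merged (gOf κ Φ t p O gv) (fOf κ Φ t p O fv))).c₁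 ((prFA κ Φ t p O.merged (gOf κ Φ t p O gv) (fOf κ Φ t p O fv))).D (HK.kgLastLoY N) (HK.kgLastHiY N) 0 ∧
      Skelφ.rdHi ((prFA κ Φ t p O.merged (gOf κ Φ t p O gv) (fOf κ Φ t p O fv))).A (nL κ Φ t p O.merged (gOf κ Φ t p O gv) (fOf κ Φ t p O fv)) (hL κ Φ t p O.merged (gOf κ Φ t p O gv) (fOf κ Φ t p O fv)) (vL κ Φ t p O.merged (gOf κ Φ t p O gv) (fOf κ Φ t p O fv)) (vβL κ Φ t p O.merged (gOf κ Φ t p O gv) (fOf κ Φ t p O fv)) ((prFA κ Φ t p O.merged (gOf κ Φ t p O gv) (fOf κ Φ t p O fv))).c₀ ((prFA κ Φ t p O.merged (gOf κ Φ t p O gv) (fOf κ Φ t p O fv))).c₁ ((prFA κ Φ t p O.merged (gOf κ Φ t p O gv) (fOf κ Φ t p O fv))).D (HK.kgLastLoY N) (HK.kgLastHiY N) 0 ≤ (((fcellsV κ Φ t p O.merged (gOf κ Φ t p O gv) (fOf κ Φ t p O fv) (cOf κ Φ t p O gv fv cv) (hOf κ Φ t p O gv fv hv))).hF 1 : ℤ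))
    -- START-BOX ROWS (`aW ≤ (n ± v) + W`, `bL ≤ qq`)
    {aW Bx bL : ℤ} (ha : ((prFA κ Φ t p O.merged (gOf κ Φ t p O gv) (fOf κ Φ t p O fv))).D * (((prFA κ Φ t p O.merged (gOf κ Φ t p O gv) (fOf κ Φ t p O fv))).c₁ * ((nL κ Φ t p O.merged (gOf κ Φ t p O gv) (fOf κ Φ t p O fv)) : ℤ) * ((bOf κ Φ t p O gv fv bv) 0 + 1) + ((prFA κ Φ t p O.merged (gOf κ Φ t p O gv) (fOf κ Φ t p O fv))).c₀ * |(vL κ Φ t p O.merged (gOf κ Φ t p O gv) (fOf κ Φ t p O fv))| * ((bOf κ Φ t p O gv fv bv) 1 + 1)) ≤ ((prFA κ Φ t p O.merged (gOf κ Φ t p O gv) (fOf κ Φ t p O fv))).c₀ * ((prFA κ Φ t p O.merged (gOf κ Φ t p O gv) (fOf κ Φ t p O fv))).c₁ * ((prFA κ Φ t p O.merged (gOf κ Φ t p O gv) (fOf κ Φ t p O fv))).A * modulus (nL κ Φ t p O.merged (gOf κ Φ t p O gv) (fOf κ Φ t p O fv)) (hL κ Φ t p O.merged (gOf κ Φ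 t p O gv) (fOf κ Φ t p O fv)) (vL κ Φ t p O.merged (gOf κ Φ t p O gv) (fOf κ Φ t p O fv)) (vβL κ Φ t p O.merged (gOf κ Φ t p O gv) (fOf κ Φ t p O fv)) * aW)
    (hBx : ((prFA κ Φ t p O.merged (gOf κ Φ t p O gv) (fOf κ Φ t p O fv))).D * (((bOf κ Φ t p O gv fv bv) 1 : ℤ) + 1) ≤ ((prFA κ Φ t p O.merged (gOf κ Φ t p O gv) (fOf κ Φ t p O fv))).c₁ * ((prFA κ Φ t p O.merged (gOf κ Φ t p O gv) (fOf κ Φ t p O fv))).A * Bx) (hbL : Bx / (Skelφ.shearUnit (nL κ Φ t p O.merged (gOf κ Φ t p O gv) (fOf κ Φ t p O fv)) (hL κ Φ t p O.merged (gOf κ Φ t p O gv) (fOf κ Φ t p O fv)) : ℤ) + 1 ≤ bL)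
    (haW : aW ≤ (((((nL κ Φ t p O.merged (gOf κ Φ t p O gv) (fOf κ Φ t p O fv)) : ℤ) + (vL κ Φ t p O.merged (gOf κ Φ t p O gv) (fOf κ Φ t p O fv))).toNat + W : ℕ) : ℤ)) (haW' : aW ≤ (((((nL κ Φ t p O.merged (gOf κ Φ t p O gv) (fOf κ Φ t p O fv)) : ℤ) - (vL κ Φ t p O.merged (gOf κ Φ t p O gv) (fOf κ Φ t p O fv))).toNat + W : ℕ) : ℤ)) (hbq : bL ≤ qq)
    -- DEPTH ROW
    (hRD : ((cOffS κ Φ t p O.merged (gOf κ Φ t p O gv) (fOf κ Φ t p O fv) * (((tgt e) 0).natAbs + ((tgt e) 1).natAbs) + 1 : ℕ) : ℤ) +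
      (10 + 3) * (((N : ℤ) + 1) * (((nL κ Φ t p O.merged (gOf κ Φ t p O gv) (fOf κ Φ t p O fv)) * (ℓL κ Φ t p O.merged (gOf κ Φ t p O gv) (fOf κ Φ t p O fv)) / Skelφ.shearUnit (nL κ Φ t p O.merged (gOf κ Φ t p O gv) (fOf κ Φ t p O fv)) (hL κ Φ t p O.merged (gOf κ Φ t p O gv) (fOf κ Φ t p O fv)) + 1 : ℕ) : ℤ) +
        Skelφ.kgZY₀ (nL κ Φ t p O.merged (gOf κ Φ t p O gv) (fOf κ Φ t p O fv)) (vL κ Φ t p O.merged (gOf κ Φ t p O gv) (fOf κ Φ t p O fv)) (KS0.R'0 κ Φ t p Dk mkP) ρ W N (Skelφ.kgM₁Y (nL κ Φ t p O.merged (gOf κ Φ t p O gv) (fOf κ Φ t p O fv)) (vL κ Φ t p O.merged (gOf κ Φ t p O gv) (fOf κ Φ t p O fv)) (KS0.R'0 κ Φ t p Dk mkP) ρ W N) (Skelφ.kgWm₂Y (nL κ Φ t p O.merged (gOf κ Φ t p O gv) (fOf κ Φ t p O fv)) (vL κ Φ t p O.merged (gOf κ Φ t p O gv) (fOf κ Φ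 t p O fv)) (KS0.R'0 κ Φ t p Dk mkP) ρ W N) (Skelφ.kgWp₂Y (nL κ Φ t p O.merged (gOf κ Φ t p O gv) (fOf κ Φ t p O fv)) (vL κ Φ t p O.merged (gOf κ Φ t p O gv) (fOf κ Φ t p O fv)) (KS0.R'0 κ Φ t p Dk mkP) ρ W N) (Skelφ.kgM₂Y (nL κ Φ t p O.merged (gOf κ Φ t p O gv) (fOf κ Φ t p O fv)) (ℓL κ Φ t p O.merged (gOf κ Φ t p O gv) (fOf κ Φ t p O fv)) (hL κ Φ t p O.merged (gOf κ Φ t p O gv) (fOf κ Φ t p O fv)) (vL κ Φ t p O.merged (gOf κ Φ t p O gv) (fOf κ Φ t p O fv)) (KS0.R'0 κ Φ t p Dk mkP) ρ qq W N) + Skelφ.kgZY₁ (nL κ Φ t p O.merged (gOf κ Φ t p O gv) (fOf κ Φ t p O fv)) (ℓL κ Φ t p O.merged (gOf κ Φ t p O gv) (fOf κ Φ t p O fv)) (hL κ Φ t p O.merged (gOf κ Φ t p O gv) (fOf κ Φ t p O fv)) (KS0.R'0 κ Φ t p Dk mkP) ρ qq N (Skelφ.kgM₁Y (nL κ Φ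 t p O.merged (gOf κ Φ t p O gv) (fOf κ Φ t p O fv)) (vL κ Φ t p O.merged (gOf κ Φ t p O gv) (fOf κ Φ t p O fv)) (KS0.R'0 κ Φ t p Dk mkP) ρ W N) (Skelφ.kgM₂Y (nL κ Φ t p O.merged (gOf κ Φ t p O gv) (fOf κ Φ t p O fv)) (ℓL κ Φ t p O.merged (gOf κ Φ t p O gv) (fOf κ Φ t p O fv)) (hL κ Φ t p O.merged (gOf κ Φ t p O gv) (fOf κ Φ t p O fv)) (vL κ Φ t p O.merged (gOf κ Φ t p O gv) (fOf κ Φ t p O fv)) (KS0.R'0 κ Φ t p Dk mkP) ρ qq W N)) ≤ R)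
    -- THE RIM EXCESS DEVICE: world rows, excess radius
    {φe : V → Site 2} {Rw m' m R₁ : ℕ} {ctr : Site 2}
    (hWπ : ∀ b ∈ (((KSchA.mk (ΓQV κ Φ t p O gv fv Sv cv hv bv q) q κ.δ : KSchA V ℕ))).Γ.Ewv ((((KSchA.mk (ΓQV κ Φ t p O gv fv Sv cv hv bv q) q κ.δ : KSchA V ℕ))).aOf₁O G h e) e.1 e.2 ∪ ((FDQV κ Φ t p O gv fv Sv cv hv q)).Hfull ((((KSchA.mk (ΓQV κ Φ t p O gv fv Sv cv hv bv q) q κ.δ : KSchA V ℕ))).aOf₂O G h e) (tgt e) ((((1 : Fin 2), true) : MDir)), b ∈ graphBall G t Rw)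
    (hWpl : ∀ b ∈ (((KSchA.mk (ΓQV κ Φ t p O gv fv Sv cv hv bv q) q κ.δ : KSchA V ℕ))).Γ.Ewv ((((KSchA.mk (ΓQV κ Φ t p O gv fv Sv cv hv bv q) q κ.δ : KSchA V ℕ))).aOf₁O G h e) e.1 e.2 ∪ ((FDQV κ Φ t p O gv fv Sv cv hv q)).Hfull ((((KSchA.mk (ΓQV κ Φ t p O gv fv Sv cv hv bv q) q κ.δ : KSchA V ℕ))).aOf₂O G h e) (tgt e) ((((1 : Fin 2), true) : MDir)), φe b ∈ (box 2 m').image (fun s => s + ctr))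
    (hm : 2 * m' ≤ m)
    (hR₁ : ∀ R'', R₁ ≤ R'' → ∀ (Rw' : ℕ) (D' A' : Finset V), (∀ d ∈ D', d ∈ graphBall G t Rw') →
      (∀ d ∈ D', ∀ d' ∈ D', φe d - φe d' ∈ box 2 m) → A' ⊆ D' → (∀ a ∈ A', a ∈ graphBall G t (R₀ + 1)) →
        (bondPercolation G q).real (excess G t R'' D' A') ≤ κ.δr 0 / 2)
    (hR₁R : R₁ ≤ R - KS0.r₀0 t Dk mkP (RL κ Φ t p O gv fv + D))
    -- the budget
    {nmax : ℕ} (hnmax : (Skelφ.kgCorrSchedYU HK.hn HK.hv HK.hlay (HK.kgYVals_ok₁ N) (HK.kgYVals_ok₂ N) (HK.kgYVals_split N)).N ≤ nmax) :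
    ReachOblAtHNF G nmax ((KSchA.mk (ΓQV κ Φ t p O gv fv Sv cv hv bv q) q κ.δ : KSchA V ℕ)) (FDQV κ Φ t p O gv fv Sv cv hv q) Φ.Δ (κ.δr 0) h e ((((KSchA.mk (ΓQV κ Φ t p O gv fv Sv cv hv bv q) q κ.δ : KSchA V ℕ))).aOf₂O G h e) ((((1 : Fin 2), true) : MDir)) := by
  -- the long clause and its numerics
  have hN := eqNumL_of_atQV (atQ3V_of_atQ3VPx hAt)
  obtain ⟨hn1, hℓ1⟩ := one_le_of_eqNumL κ Φ t p O.merged (gOf κ Φ t p O gv) (fOf κ Φ t p O fv) hN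
  have hκL := (clauseL_of_atQV (atQ3V_of_atQ3VPx hAt)).2
  obtain ⟨-, hq1, hq2, -⟩ := factsNS_of_atQV (atQ3V_of_atQ3VPx hAt)
  -- the short region UNDER PROXIES (K-2 shape, as «SkelFrmFrom1RootHoldsQCKVPx» :146–:163): the kit parallelogram about `c` at radius `RK mk + D`
  -- («SkelFrmFromBChoiceZoneKPx» prism form) — inside `B(c, Rs(Dk, mkP))` by `hRK`, of cardinality `≤ cUA(Dk, mkP)`, containing the zone `Λ (prox c) M_u`
  have hRg : ∀ c, ∀ u ∈ Skelφ.pgramPrismFin G (KS.φK Φ t O.D O.DT.toDataN O.ori mk) c (KS.nKit O.merged mk) (KS.hKit t O.merged mk) (3 * KS.ℓKit t O.merged mk) (KS.RK t O.merged mk + D),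
      u ∈ graphBall G c (KS.Rs t Dk mkP) := fun c u hu =>
    graphBall_mono G c (hRK.trans (KS.RK_le_Rs t Dk mkP).1)
      (Skelφ.cylBall_subset_prism G (KS.φK Φ t O.D O.DT.toDataN O.ori mk) c _ _ ((Skelφ.mem_pgramPrismFin G (KS.φK Φ t O.D O.DT.toDataN O.ori mk)).1 hu).1).1
  have hRgcard : ∀ c, (Skelφ.pgramPrismFin G (KS.φK Φ t O.D O.DT.toDataN O.ori mk) c (KS.nKit O.merged mk) (KS.hKit t O.merged mk) (3 * KS.ℓKit t O.merged mk) (KS.RK t O.merged mk + D)).card ≤ KS.cUA Φ t Dk mkP := fun c => by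
    classical
    refine le_trans (Finset.card_le_card fun v hv => ?_) ((Skelφ.card_cylBallFin_le (φ := KS.φK Φ t O.D O.DT.toDataN O.ori mk) Φ.degree_le c
      (Skelφ.pgScale (KS.nKit O.merged mk) (KS.hKit t O.merged mk) (3 * KS.ℓKit t O.merged mk)) (KS.RK t O.merged mk + D)).trans
      (Nat.pow_le_pow_right (Nat.succ_pos _) hRK))
    rw [Skelφ.mem_cylBallFin]
    exact ((Skelφ.mem_pgramPrismFin G (KS.φK Φ t O.D O.DT.toDataN O.ori mk)).1 hv).1
  have hΛRgK : ∀ c, O.merged.Λ (hP.prox c) (Mu O.merged) ⊆ Skelφ.pgramPrismFin G (KS.φK Φ t O.D O.DT.toDataN O.ori mk) c (KS.nKit O.merged mk) (KS.hKit t O.merged mk) (3 * KS.ℓKit t O.merged mk) (KS.RK t O.merged mk + D) := fun c a ha =>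
    (Skelφ.mem_pgramPrismFin G (KS.φK Φ t O.D O.DT.toDataN O.ori mk)).2 (hΛRg_of_atQPx mk (atQ3_of_atQ3VPx hAt) hP (D_le_nKit_of_atQ3VPx hAt mk) c (Finset.mem_coe.2 ha))
  -- the frame
  have hlipφ := lip_φL κ Φ t p O.D O.DT.toDataN O.ori (gOf κ Φ t p O gv) (fOf κ Φ t p O fv)
  have hstep := steps_φL κ Φ t p O.D O.DT.toDataN O.ori (gOf κ Φ t p O gv) (fOf κ Φ t p O fv)
  -- the Γ package at the staggered cells
  obtain ⟨-, -, -, -, -, -, hEx, hSt, hLG⟩ := geom_fineA_at_bV κ Φ t p O.merged (gOf κ Φ t p O gv) (fOf κ Φ t p O fv) (cOf κ Φ t p O gv fv cv) (hOf κ Φ t p O gv fv hv) hlipφ hstep hN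
    (schedOfT_WFS2 κ Φ t p O.merged (gOf κ Φ t p O gv) (fOf κ Φ t p O fv) (cOf κ Φ t p O gv fv cv) (Sv κ Φ t p O.merged (gOf κ Φ t p O gv) (fOf κ Φ t p O fv) q)) (colQ_schedOfT κ Φ t p O.merged (gOf κ Φ t p O gv) (fOf κ Φ t p O fv) (cOf κ Φ t p O gv fv cv) (Sv κ Φ t p O.merged (gOf κ Φ t p O gv) (fOf κ Φ t p O fv) q))
    (b₀ := (bOf κ Φ t p O gv fv bv)) (bOf_leV κ Φ t p O gv fv cv hv bv)
  -- the kit block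
  obtain ⟨hPN, hdD, hDρ, hKCmax, hT, -⟩ := KS0.kit0_ok t Dk mkP ((Mu Dk + 1 : ℕ) * (Skelφ.shearUnit (nL κ Φ t p O.merged (gOf κ Φ t p O gv) (fOf κ Φ t p O fv)) (hL κ Φ t p O.merged (gOf κ Φ t p O gv) (fOf κ Φ t p O fv)) : ℤ) + 1)
    (KS0.r₀0 t Dk mkP (RL κ Φ t p O gv fv + D)) (kq := 10) le_rfl
  obtain ⟨hrs, hcS⟩ := KS0.kit0_sizes Φ t Dk mkP ((Mu Dk + 1 : ℕ) * (Skelφ.shearUnit (nL κ Φ t p O.merged (gOf κ Φ t p O gv) (fOf κ Φ t p O fv)) (hL κ Φ t p O.merged (gOf κ Φ t p O gv) (fOf κ Φ t p O fv)) : ℤ) + 1) (KS0.r₀0 t Dk mkP (RL κ Φ t p O gv fv + D))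
  obtain ⟨hr₀, hr₀1⟩ := KS0.hr₀_kit0 t Dk mkP ((Mu Dk + 1 : ℕ) * (Skelφ.shearUnit (nL κ Φ t p O.merged (gOf κ Φ t p O gv) (fOf κ Φ t p O fv)) (hL κ Φ t p O.merged (gOf κ Φ t p O gv) (fOf κ Φ t p O fv)) : ℤ) + 1) (KS0.r₀0_ge t Dk mkP (RL κ Φ t p O gv fv + D)).1
  have hreach := KS0.hreach_kit0 t Dk mkP ((Mu Dk + 1 : ℕ) * (Skelφ.shearUnit (nL κ Φ t p O.merged (gOf κ Φ t p O gv) (fOf κ Φ t p O fv)) (hL κ Φ t p O.merged (gOf κ Φ t p O gv) (fOf κ Φ t p O fv)) : ℤ) + 1) (KS0.r₀0_ge t Dk mkP (RL κ Φ t p O gv fv + D)).2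
  -- the counts at the flat root accuracy
  obtain ⟨hk, hcount⟩ := KS0.counts_atq_root κ Φ t p Dk mkP hp0 hp1 hq1 hq2
  -- levels
  have hE : KS0.j₁0 κ Φ t p Dk mkP +
      ((KS0.kit0 t Dk mkP ((Mu Dk + 1 : ℕ) * (Skelφ.shearUnit (nL κ Φ t p O.merged (gOf κ Φ t p O gv) (fOf κ Φ t p O fv)) (hL κ Φ t p O.merged (gOf κ Φ t p O gv) (fOf κ Φ t p O fv)) : ℤ) + 1) (KS0.r₀0 t Dk mkP (RL κ Φ t p O gv fv + D))).N *
          (tanOff (KS0.kit0 t Dk mkP ((Mu Dk + 1 : ℕ) * (Skelφ.shearUnit (nL κ Φ t p O.merged (gOf κ Φ t p O gv) (fOf κ Φ t p O fv)) (hL κ Φ t p O.merged (gOf κ Φ t p O gv) (fOf κ Φ t p O fv)) : ℤ) + 1) (KS0.r₀0 t Dk mkP (RL κ Φ t p O gv fv + D))).ℓs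
            (KS0.kit0 t Dk mkP ((Mu Dk + 1 : ℕ) * (Skelφ.shearUnit (nL κ Φ t p O.merged (gOf κ Φ t p O gv) (fOf κ Φ t p O fv)) (hL κ Φ t p O.merged (gOf κ Φ t p O gv) (fOf κ Φ t p O fv)) : ℤ) + 1) (KS0.r₀0 t Dk mkP (RL κ Φ t p O gv fv + D))).M + 1) +
        (KS0.kit0 t Dk mkP ((Mu Dk + 1 : ℕ) * (Skelφ.shearUnit (nL κ Φ t p O.merged (gOf κ Φ t p O gv) (fOf κ Φ t p O fv)) (hL κ Φ t p O.merged (gOf κ Φ t p O gv) (fOf κ Φ t p O fv)) : ℤ) + 1) (KS0.r₀0 t Dk mkP (RL κ Φ t p O gv fv + D))).N *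
          (KS0.kit0 t Dk mkP ((Mu Dk + 1 : ℕ) * (Skelφ.shearUnit (nL κ Φ t p O.merged (gOf κ Φ t p O gv) (fOf κ Φ t p O fv)) (hL κ Φ t p O.merged (gOf κ Φ t p O gv) (fOf κ Φ t p O fv)) : ℤ) + 1) (KS0.r₀0 t Dk mkP (RL κ Φ t p O gv fv + D))).d +
        KS.KCmax t Dk mkP) ≤ KS0.R'0 κ Φ t p Dk mkP := by
    rw [KS0.tanOff_kit0]
    simp only [KS0.kit0]
    have h := (KS0.R'0_eq κ Φ t p Dk mkP).1
    unfold KS0.reach0 at h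
    omega
  exact Skelφ.reachOblAtHNF_of_kgCorrYVU (φ := (φL κ Φ t p O.D O.DT.toDataN O.ori (gOf κ Φ t p O gv) (fOf κ Φ t p O fv))) (ψ := (fineOA κ Φ t p O.D O.DT.toDataN O.ori (gOf κ Φ t p O gv) (fOf κ Φ t p O fv))) (P := (fcellsV κ Φ t p O.merged (gOf κ Φ t p O gv) (fOf κ Φ t p O fv) (cOf κ Φ t p O gv fv cv) (hOf κ Φ t p O gv fv hv))) (w₀ := t) (Λ := (schedOfT κ Φ t p O.merged (gOf κ Φ t p O gv) (fOf κ Φ t p O fv) (cOf κ Φ t p O gv fv cv) (Sv κ Φ t p O.merged (gOf κ Φ t p O gv) (fOf κ Φ t p O fv) q))) (b₀ := (bOf κ Φ t p O gv fv bv)) (q := q) (δc := κ.δ)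
    (hψ := fineOA_eq_fineSkel) (hAp := (Aof_pos κ).1) (hmp := Skelφ.NegPrm.modulus_vβOf_pos hn1 hℓ1 _ _)
    (hc₀p := (prFA_c_pos κ Φ t p O.merged (gOf κ Φ t p O gv) (fOf κ Φ t p O fv)).1) (hc₁p := (prFA_c_pos κ Φ t p O.merged (gOf κ Φ t p O gv) (fOf κ Φ t p O fv)).2)
    (hDp := Skelφ.NegPrm.DofA_pos (Aof_pos κ).2 hn1 hℓ1 _ _)
    (hlip := lip_fineA_at κ Φ t p O.merged (gOf κ Φ t p O gv) (fOf κ Φ t p O fv) hlipφ hN) (hws := weakSteps_fineA_at κ Φ t p O.merged (gOf κ Φ t p O gv) (fOf κ Φ t p O fv) hstep hN)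
    (hb := bOf_leV κ Φ t p O gv fv cv hv bv) (hL := hLG) (hSt := hSt) (hEx := hEx) (hV := hV) (hdu := hdu) (hdu' := hne)
    (hlipφ := hlipφ) (hstep := hstep) (hΔ := Φ.degree_le) (hn := HK.hn) (hvn := HK.hv) (hlay := HK.hlay)
    (c₀ := colVT κ Φ t p O.merged (gOf κ Φ t p O gv) (fOf κ Φ t p O fv) (cOf κ Φ t p O gv fv cv) hlipφ hstep hN (tgt e)) (kq := 10) (hκL := hκL)
    (hctr := colVT_eq κ Φ t p O.merged (gOf κ Φ t p O gv) (fOf κ Φ t p O fv) (cOf κ Φ t p O gv fv cv) hlipφ hstep hN (tgt e))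
    (hP₁ := HK.kgYVals_ok₁ N) (hP₂ := HK.kgYVals_ok₂ N) (hsplit := HK.kgYVals_split N) (r := RL κ Φ t p O gv fv + D) (hr := le_rfl)
    (hrR := le_trans (Nat.le_add_right _ _) ((KS0.r₀0_ge t Dk mkP (RL κ Φ t p O gv fv + D)).2.trans hr₀R))
    (Pk := KS0.kit0 t Dk mkP ((Mu Dk + 1 : ℕ) * (Skelφ.shearUnit (nL κ Φ t p O.merged (gOf κ Φ t p O gv) (fOf κ Φ t p O fv)) (hL κ Φ t p O.merged (gOf κ Φ t p O gv) (fOf κ Φ t p O fv)) : ℤ) + 1) (KS0.r₀0 t Dk mkP (RL κ Φ t p O gv fv + D)))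
    (hPN := hPN) (hA := rfl) (hdD := hdD) (hDρ := hDρ) (hKCmax := hKCmax) (hT := hT) (hr₀ := hr₀) (hR := hr₀R) (hr₀1 := hr₀1)
    (hrs := hrs) (hcS := hcS) (hreach := hreach)
    (Rg := fun c => Skelφ.pgramPrismFin G (KS.φK Φ t O.D O.DT.toDataN O.ori mk) c (KS.nKit O.merged mk) (KS.hKit t O.merged mk) (3 * KS.ℓKit t O.merged mk) (KS.RK t O.merged mk + D))
    (hRg := hRg) (hRgcard := hRgcard)
    (hcU1 := Nat.one_le_pow _ _ (Nat.succ_pos _))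
    (Λc := fun c => O.merged.Λ (hP.prox c)) (kz := Mu O.merged) (hΛRg := hΛRgK)
    (hzconn := hzconn_of_atQPx (atQ3_of_atQ3VPx hAt) hP (D_le_Mu_of_atQ3VPx hAt)) (hcz := hcz_of_atQPx (atQ3_of_atQ3VPx hAt) hP (D_le_Mu_of_atQ3VPx hAt))
    (hj0 := (KS0.tanOff_kit0 t Dk mkP _ _).le) (hj := (KS0.R'0_eq κ Φ t p Dk mkP).2.2) (hRl := (KS0.R'0_eq κ Φ t p Dk mkP).2.1.le)
    (hE := hE) (hδ := (κ.hδr 0).1) (hη := le_rfl) (kk := KS0.kk0 κ Φ t p Dk mkP) (hN := KS0.hNk0_at κ Φ t p Dk mkP hp0 hp1)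
    (hk := hk) (hcount := hcount)
    (hDQ := hDQ) (hDρ' := hDρ') (hρM := hρM) (hdeep := hdeep) (hPR := hPR) (hlast := fun y hy => HK.mem_Icc_of_mem_lastY N hy) (hLl := hLl) (hLt := hLt)
    (ha := ha) (hBx := hBx) (hbL := hbL) (haW := haW) (haW' := haW') (hbq := hbq)
    (hc₀ := colVT_mem_graphBall_lin κ Φ t p O.merged (gOf κ Φ t p O gv) (fOf κ Φ t p O fv) (cOf κ Φ t p O gv fv cv) hlipφ hstep hN hκL (tgt e)) (hRD := hRD)
    (hWπ := hWπ) (hWpl := hWpl) (hm := hm) (hR₁ := hR₁) (hR₁R := hR₁R)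
    (hlong := hlong_of_atQ3VPx (atQ3V_of_atQ3VPx hAt) hP (D_le_nL_of_atQ3VPx hAt _ _) (Neg.δkit_le_δr κ Φ (by norm_num)))
    (hlongY := hlongY_of_atQ3VPx (atQ3V_of_atQ3VPx hAt) hP (D_le_nL_of_atQ3VPx hAt _ _) (Neg.δkit_le_δr κ Φ (by norm_num)))
    (hnmax := hnmax)

end Fst

end NegB

end PlanarSkeletonFrmFrom

end Summit.CriticalPhenomena.PercolationContinuityZ3.Theorems.Transplant

end
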